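/-
Copyright: rh-split cell (dbn column, prover seat l19-w2) gen 0, 2026-08-27.  LINE 3 «two-ray Laguerre
squeeze» of ideator rh-idea-2 (D-0145).  The linear-factor ray `HasOnlyRealZeros (linearFactorH a)` is an
RH-STRENGTHENING conjunct (`LinearRayTwoPoint.riemannHypothesis_of_linearRay`); everything here is a
CONDITIONAL certificate GIVEN the ray.  Nothing here bears on the truth of RH.
-/
import Summits.RiemannHypothesis.RiemannHypothesis.Theorems.Splittings.LinearRayRh
import Literature.NumberTheory.LFunctions.XiMoments
import HarnessLib

/-!
# The two one-point Laguerre sign rules at a real zero of `H_0`, GIVEN the linear-factor ray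

Objects (all existing declarations; this file declares no definitions): de Bruijn's `H_0 = deBruijnH 0`,
its derivative data `H_0^{(k)} = deBruijnH0Deriv k` (`Literature/NumberTheory/LFunctions/XiMoments.lean`),
the Laplace-smoothed factor `F_a = deBruijnHDiv (1 + u²/a²)`, the ray function
`G_a := F_a' + a·F_a` written out as
`deriv (deBruijnHDiv fun u : ℝ => 1 + u ^ 2 / a ^ 2) z + (a : ℂ) * deBruijnHDiv (fun u : ℝ => 1 + u ^ 2 / a ^ 2) z`
(as in `Theorems/Splittings/LinearRayRh.lean`), and the linear-factor ray member
`linearFactorH a = a⁻¹·G_a` (`LinearRayTwoPoint.linearFactorH_eq_inv_mul_rayG`) of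
`Literature/Barriers/RiemannHypothesis/NewmanConjecture.lean`.

**Content.**
* `deriv_deriv_rayG` / `re_deriv_deriv_rayG_ofReal`: the second derivative of `G_a` from the tree ODE
  `G_a' = a·G_a − a²·H_0` (`LinearRayTwoPoint.deriv_rayG`): `G_a'' = a·(a·G_a − a²·H_0) − a²·H_0'`.
* `re_rayG_mul_re_deBruijnH0Deriv_one_nonneg` (**one-point sign rule**, any `a ≠ 0`, GIVEN the ray): at a
  real zero `x` of `H_0`, `0 ≤ Re G_a(x) · Re H_0'(x)` — Laguerre's inequality `G G'' ≤ G'²` on the ray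
  (`LinearRayTwoPoint.laguerre_rayG`) at `x`, where `G_a'(x) = a·G_a(x)` and `G_a''(x) = a²·G_a(x) − a²·H_0'(x)`,
  reads `−a²·G_a(x)·H_0'(x) ≤ 0`.
* `re_linearFactorH_mul_nonneg` / `re_linearFactorH_neg_mul_nonpos`: for `a > 0` the member
  `linearFactorH a = a⁻¹ G_a` takes the sign of `H_0'(x)` (weakly) and the MIRROR member
  `linearFactorH (−a) = (−a)⁻¹ G_{−a}` (ray by `hasOnlyRealZeros_linearFactorH_neg_iff`) the opposite sign.
* `linearRayMirrorSqueeze` (**item `DBN.LinearRayMirrorSqueeze`, stmt-RiemannHypothesis-22359, unfolded**):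
  under the ray, at every SIMPLE real zero `x` of `H_0`,
  `Re linearFactorH a (x) · Re linearFactorH (−a) (x) ≤ 0`.

This is support for LINE 3's swing lemma (`DBN.LinearRaySwingLemma`); it is the conjunction of two B20-type
one-point Laguerre certificates and carries no claim about RH.  No `sorry`, no new axioms, no instances,
no notation, no definitions.
-/

set_option linter.dupNamespace false  -- the mandated namespace repeats `RiemannHypothesis`

namespace Summit.RiemannHypothesis.RiemannHypothesis.Theorems.Splittings.LinearRayZeroSigns

open Complex Filter Topology Set
open Literature.NumberTheory.LFunctions Literature.Analysis.Complex
open Literature.Barriers.RiemannHypothesis (linearFactorH hasOnlyRealZeros_linearFactorH_neg_iff)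
open Summit.RiemannHypothesis.RiemannHypothesis.Theorems
open Summit.RiemannHypothesis.RiemannHypothesis.Theorems.Splittings.LinearRayTwoPoint

/-! ## `H_0' = H_0^{(1)}` and its realness on the real axis -/

/-- `H_0` has derivative `H_0^{(1)}` (the tree's `deBruijnH0Deriv 1`) everywhere. [folklore] -/
theorem hasDerivAt_deBruijnH_zero (z : ℂ) : HasDerivAt (deBruijnH 0) (deBruijnH0Deriv 1 z) z := by
  have h := hasDerivAt_deBruijnH0Deriv 0 z
  rwa [deBruijnH0Deriv_zero] at h

/-- `deriv H_0 = H_0^{(1)}`. [folklore] -/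
theorem deriv_deBruijnH_zero : deriv (deBruijnH 0) = deBruijnH0Deriv 1 :=
  funext fun z ↦ (hasDerivAt_deBruijnH_zero z).deriv

/-- `H_0^{(1)}(x)` is real for real `x`. [folklore] -/
theorem deBruijnH0Deriv_one_ofReal_im (x : ℝ) : (deBruijnH0Deriv 1 (x : ℂ)).im = 0 := by
  have hdiff : Differentiable ℂ (deBruijnH 0) := fun z ↦ (hasDerivAt_deBruijnH_zero z).differentiableAt
  have hreal : ∀ y : ℝ, (deBruijnH 0 y).im = 0 := fun y ↦ by
    rw [← deBruijnHDiv_one']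
    exact deBruijnHDiv_ofReal_im _ y
  have h := im_deriv_ofReal hdiff hreal x
  rwa [deriv_deBruijnH_zero] at h

/-- At a real point, `H_0^{(1)}(x) ≠ 0` iff its real part is non-zero. [folklore] -/
theorem re_deBruijnH0Deriv_one_ne_zero {x : ℝ} (hx : deBruijnH0Deriv 1 (x : ℂ) ≠ 0) :
    (deBruijnH0Deriv 1 (x : ℂ)).re ≠ 0 := fun h ↦
  hx (Complex.ext (by simpa using h) (by simpa using deBruijnH0Deriv_one_ofReal_im x))

/-! ## The second derivative of `G_a` -/

/-- `G_a'' = a·(a·G_a − a²·H_0) − a²·H_0'` on `ℂ` (differentiate the ODE `deriv_rayG`). -/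
theorem deriv_deriv_rayG {a : ℝ} (ha : a ≠ 0) (z : ℂ) :
    deriv (deriv (fun z : ℂ => deriv (deBruijnHDiv fun u : ℝ => 1 + u ^ 2 / a ^ 2) z + (a : ℂ) * deBruijnHDiv (fun u : ℝ => 1 + u ^ 2 / a ^ 2) z)) z
      = (a : ℂ) * ((a : ℂ) * (deriv (deBruijnHDiv fun u : ℝ => 1 + u ^ 2 / a ^ 2) z + (a : ℂ) * deBruijnHDiv (fun u : ℝ => 1 + u ^ 2 / a ^ 2) z) - (a : ℂ) ^ 2 * deBruijnH 0 z)
        - (a : ℂ) ^ 2 * deBruijnH0Deriv 1 z := by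
  rw [show deriv (fun z : ℂ => deriv (deBruijnHDiv fun u : ℝ => 1 + u ^ 2 / a ^ 2) z + (a : ℂ) * deBruijnHDiv (fun u : ℝ => 1 + u ^ 2 / a ^ 2) z)
      = fun z : ℂ => (a : ℂ) * (deriv (deBruijnHDiv fun u : ℝ => 1 + u ^ 2 / a ^ 2) z + (a : ℂ) * deBruijnHDiv (fun u : ℝ => 1 + u ^ 2 / a ^ 2) z) - (a : ℂ) ^ 2 * deBruijnH 0 z
      from funext fun z ↦ deriv_rayG ha z]
  exact (((((differentiable_rayG a) z).hasDerivAt).const_mul (a : ℂ)).sub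
    ((hasDerivAt_deBruijnH_zero z).const_mul ((a : ℂ) ^ 2))).deriv.trans (by rw [deriv_rayG ha z])

/-- Real form on the real axis: `Re G_a''(s) = a·(a·Re G_a(s) − a²·Re H_0(s)) − a²·Re H_0^{(1)}(s)`. -/
theorem re_deriv_deriv_rayG_ofReal {a : ℝ} (ha : a ≠ 0) (s : ℝ) :
    (deriv (deriv (fun z : ℂ => deriv (deBruijnHDiv fun u : ℝ => 1 + u ^ 2 / a ^ 2) z + (a : ℂ) * deBruijnHDiv (fun u : ℝ => 1 + u ^ 2 / a ^ 2) z)) s).re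
      = a * (a * ((deriv (deBruijnHDiv fun u : ℝ => 1 + u ^ 2 / a ^ 2) s + (a : ℂ) * deBruijnHDiv (fun u : ℝ => 1 + u ^ 2 / a ^ 2) s)).re - a ^ 2 * (deBruijnH 0 s).re)
        - a ^ 2 * (deBruijnH0Deriv 1 s).re := by
  rw [deriv_deriv_rayG ha, show ((a : ℂ) ^ 2) = ((a ^ 2 : ℝ) : ℂ) by push_cast; ring]
  simp only [Complex.sub_re, Complex.re_ofReal_mul]

/-! ## The one-point sign rule at a real zero of `H_0` -/

/-- **One-point Laguerre sign rule** (any `a ≠ 0`, GIVEN the ray `HasOnlyRealZeros (linearFactorH a)`): at a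
real zero `x` of `H_0`, `0 ≤ Re G_a(x) · Re H_0^{(1)}(x)`.  From Laguerre `G G'' ≤ G'²` on the real axis
(`laguerre_rayG`) with `G_a'(x) = a G_a(x)`, `G_a''(x) = a² G_a(x) − a² H_0'(x)`. -/
theorem re_rayG_mul_re_deBruijnH0Deriv_one_nonneg {a : ℝ} (ha : a ≠ 0)
    (h : HasOnlyRealZeros (linearFactorH a)) {x : ℝ} (hx : deBruijnH 0 (x : ℂ) = 0) :
    0 ≤ ((deriv (deBruijnHDiv fun u : ℝ => 1 + u ^ 2 / a ^ 2) x + (a : ℂ) * deBruijnHDiv (fun u : ℝ => 1 + u ^ 2 / a ^ 2) x)).re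
      * (deBruijnH0Deriv 1 (x : ℂ)).re := by
  have hL := laguerre_rayG ha h x
  rw [re_deriv_rayG ha x, re_deriv_deriv_rayG_ofReal ha x, hx, Complex.zero_re, mul_zero, sub_zero] at hL
  -- `hL : U * (a * (a * U) - a² * D) ≤ (a * U)²`, i.e. `-a² * U * D ≤ 0`
  have ha2 : 0 < a ^ 2 := by positivity
  nlinarith [hL, ha2]

/-- On the real axis `Re linearFactorH a (x) = a⁻¹ · Re G_a(x)` (`a ≠ 0`). [folklore] -/
theorem re_linearFactorH_ofReal {a : ℝ} (ha : a ≠ 0) (x : ℝ) :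
    (linearFactorH a (x : ℂ)).re
      = a⁻¹ * ((deriv (deBruijnHDiv fun u : ℝ => 1 + u ^ 2 / a ^ 2) x + (a : ℂ) * deBruijnHDiv (fun u : ℝ => 1 + u ^ 2 / a ^ 2) x)).re := by
  rw [linearFactorH_eq_inv_mul_rayG ha, ← Complex.ofReal_inv, Complex.re_ofReal_mul]

/-- **Sign of the member `linearFactorH a`, `a > 0`**, at a real zero `x` of `H_0`, GIVEN the ray:
`0 ≤ Re linearFactorH a (x) · Re H_0^{(1)}(x)`. -/
theorem re_linearFactorH_mul_nonneg {a : ℝ} (ha : 0 < a) (h : HasOnlyRealZeros (linearFactorH a))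
    {x : ℝ} (hx : deBruijnH 0 (x : ℂ) = 0) :
    0 ≤ (linearFactorH a (x : ℂ)).re * (deBruijnH0Deriv 1 (x : ℂ)).re := by
  rw [re_linearFactorH_ofReal ha.ne', mul_assoc]
  exact mul_nonneg (inv_nonneg.2 ha.le) (re_rayG_mul_re_deBruijnH0Deriv_one_nonneg ha.ne' h hx)

/-- **Sign of the MIRROR member `linearFactorH (−a)`, `a > 0`**, at a real zero `x` of `H_0`, GIVEN the ray
of `linearFactorH a` (equivalently of `linearFactorH (−a)`, `hasOnlyRealZeros_linearFactorH_neg_iff`):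
`Re linearFactorH (−a) (x) · Re H_0^{(1)}(x) ≤ 0`. -/
theorem re_linearFactorH_neg_mul_nonpos {a : ℝ} (ha : 0 < a) (h : HasOnlyRealZeros (linearFactorH a))
    {x : ℝ} (hx : deBruijnH 0 (x : ℂ) = 0) :
    (linearFactorH (-a) (x : ℂ)).re * (deBruijnH0Deriv 1 (x : ℂ)).re ≤ 0 := by
  have hna : -a ≠ 0 := neg_ne_zero.2 ha.ne'
  have h' : HasOnlyRealZeros (linearFactorH (-a)) := (hasOnlyRealZeros_linearFactorH_neg_iff a).2 h
  rw [re_linearFactorH_ofReal hna, mul_assoc]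
  exact mul_nonpos_of_nonpos_of_nonneg (inv_nonpos.2 (neg_nonpos.2 ha.le))
    (re_rayG_mul_re_deBruijnH0Deriv_one_nonneg hna h' hx)

/-! ## The mirror squeeze at a simple real zero -/

/-- **Two-ray mirror squeeze** (item `DBN.LinearRayMirrorSqueeze` of route `DBN`, stmt-RiemannHypothesis-22359,
unfolded): for `a > 0`, GIVEN the ray `HasOnlyRealZeros (linearFactorH a)`, at every SIMPLE real zero `x` of
`H_0` (`H_0(x) = 0`, `H_0^{(1)}(x) ≠ 0`) the two rays take weakly opposite signs:
`Re linearFactorH a (x) · Re linearFactorH (−a) (x) ≤ 0`.  (Multiply the two one-point sign rules and cancel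
`(Re H_0^{(1)}(x))² > 0`.)  A CONDITIONAL certificate given the RH-strengthening ray; nothing here bears on
the truth of RH. -/
theorem linearRayMirrorSqueeze {a : ℝ} (ha : 0 < a) (h : HasOnlyRealZeros (linearFactorH a)) {x : ℝ}
    (hx : deBruijnH 0 ((x : ℝ) : ℂ) = 0) (hx' : deBruijnH0Deriv 1 ((x : ℝ) : ℂ) ≠ 0) :
    (linearFactorH a ((x : ℝ) : ℂ)).re * (linearFactorH (-a) ((x : ℝ) : ℂ)).re ≤ 0 := by
  have h₁ := re_linearFactorH_mul_nonneg ha h hx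
  have h₂ := re_linearFactorH_neg_mul_nonpos ha h hx
  have hD : 0 < (deBruijnH0Deriv 1 (x : ℂ)).re * (deBruijnH0Deriv 1 (x : ℂ)).re :=
    mul_self_pos.2 (re_deBruijnH0Deriv_one_ne_zero hx')
  nlinarith [mul_nonpos_of_nonneg_of_nonpos h₁ h₂, hD]

end Summit.RiemannHypothesis.RiemannHypothesis.Theorems.Splittings.LinearRayZeroSigns
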